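import Mathlib
import HarnessLib
import Literature.LinearAlgebra.Matrix.UnitaryGroupConjugacyClasses
import Literature.MathematicalPhysics.QuantumLattice.GaugeGroups
import Literature.MathematicalPhysics.QuantumFieldTheory.Balaban1983to89.HaarRegularElementsNull
import Summits.Ventures.LatticeQCDFlow.Exactness.FlowPushforward
import Summits.Ventures.LatticeQCDFlow.Exactness.SubgroupProductHaar

/-!
# The spectral recipe OFF THE WALLS: a kernel that follows the recipe only at simple spectra is Haar-a.e. a kernel that follows it everywhere

HONEST FRAMING: exact (Metropolis-corrected) sampling algorithms for lattice gauge theory;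
figures of merit are autocorrelation/cost numbers at stated couplings and volumes; no
continuum-physics claim.

Venture `LatticeQCDFlow` (cell pub-lqcd), topic `Exactness`; FANOUT row 10 (`eng-equiv`, engine
`latflow.equiv` `spectral.spectral_kernel`).  NEW WORK of the cell.  The spectral exactness theorems of
this topic ask the kernel `h` to follow the recipe `h(V·diag d·V⋆) = V·diag(f d)·V⋆` in EVERY unitary
diagonalization and the eigenvalue map `f` to be permutation-equivariant at EVERY point of the unimodular
torus.  At a wall (two equal eigen-phases) this forces a compatibility the engine does not have (its
sort-into-the-cell step is arbitrary there).  The walls are Haar-null (the tree's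
`haar_specialUnitaryGroup_setOf_not_separable_eq_zero`, Bröcker–tom Dieck IV (2.11)(ii)), and an exact
transport is insensitive to a null modification of the map and of the density (`HasJacobian.congr_ae_map`).
This file provides the bookkeeping: replace `f` by `f'` (`= f` at injective `d`, identity elsewhere),
`h` by `h'` (`= h` at simple spectrum, identity elsewhere), the spectral datum `JD` by `JD'` (`= JD` at
injective `d`, `1` elsewhere); then `f'`, `h'`, `JD'` satisfy the EVERYWHERE hypotheses as soon as
`f`, `h`, `JD` satisfy them at simple spectra, and `h' = h`, `J' = J` Haar-a.e.  Nothing is cited as a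
fact; no number; no definition (the primed objects enter through characterising hypotheses, their
existence is a lemma).

## What is typed

* **`HasJacobian.congr_ae_map`** — `HasJacobian vol F J`, `F' = F` and `J' = J` `vol`-a.e., `F'`, `J'`
  measurable ⇒ `HasJacobian vol F' J'` (the tree's `HasJacobian.congr_ae` varies the Jacobian only);
* `separable_charpoly_iff_injective_of_conj` — for `P = V·diag d·V⋆`, `V` unitary: `χ_P` separable iff
  `d` injective;
* `measurableSet_setOf_injective`, `exists_wallId_eigenvalueMap`, `exists_wallId_kernel`,
  `exists_wallId_datum` — measurable primed objects exist;
* `perm_wallId`, `norm_wallId`, `prod_wallId`, **`hagree_wallId`**, `perm_wallId_datum`,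
  **`spec_wallId_datum`** — the everywhere hypotheses for the primed objects from the simple-spectrum
  hypotheses for the original ones;
* **`ae_eq_of_eqOn_separable`** — two functions on `SU(N)` agreeing at simple spectra are Haar-a.e. equal.
-/

noncomputable section

namespace Summit.Ventures.LatticeQCDFlow.Exactness

open MeasureTheory Matrix Set
open Literature.MathematicalPhysics.QuantumFieldTheory (haarProbability)
open scoped ENNReal

/-! ## Exact transports are insensitive to null modifications -/

/-- **`HasJacobian` along a.e. equal data.**  If `F` transports `J·vol` to `vol` and `F' = F`, `J' = J`
`vol`-a.e. with `F'`, `J'` measurable, then `F'` transports `J'·vol` to `vol`. -/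
theorem HasJacobian.congr_ae_map {Ω : Type*} [MeasurableSpace Ω] {vol : Measure Ω} {F F' : Ω → Ω}
    {J J' : Ω → ℝ≥0∞} (h : HasJacobian vol F J) (hF : F' =ᵐ[vol] F) (hJ : J' =ᵐ[vol] J)
    (hF'm : Measurable F') (hJ'm : Measurable J') : HasJacobian vol F' J' where
  measurable := hF'm
  measurable_jac := hJ'm
  map_eq := by
    rw [withDensity_congr_ae hJ]
    have hF2 : F' =ᵐ[vol.withDensity J] F := (withDensity_absolutelyContinuous vol J).ae_le hF
    rw [Measure.map_congr hF2, h.map_eq]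

variable {n : Type} [Fintype n] [DecidableEq n]

/-! ## Simple spectrum = separable characteristic polynomial -/

/-- For `P = V·diag d·V⋆` with `V` unitary, `χ_P` is separable iff the spectrum `d` is injective. -/
theorem separable_charpoly_iff_injective_of_conj {P V : Matrix n n ℂ} {d : n → ℂ}
    (hV : V ∈ Matrix.unitaryGroup n ℂ) (hP : P = V * diagonal d * star V) :
    P.charpoly.Separable ↔ Function.Injective d := by
  rw [hP, Literature.LinearAlgebra.Matrix.charpoly_conj_of_mem_unitaryGroup hV, Matrix.charpoly_diagonal]
  exact Polynomial.separable_prod_X_sub_C_iff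

/-- The set of injective spectra is measurable. -/
theorem measurableSet_setOf_injective : MeasurableSet {d : n → ℂ | Function.Injective d} := by
  have hset : {d : n → ℂ | Function.Injective d} = ⋂ i, ⋂ j, {d | d i = d j → i = j} := by
    ext d
    simp only [mem_setOf_eq, mem_iInter, Function.Injective]
  rw [hset]
  refine MeasurableSet.iInter fun i => MeasurableSet.iInter fun j => ?_
  by_cases hij : i = j
  · have h0 : {d : n → ℂ | d i = d j → i = j} = univ := by
      ext d
      simp [hij]
    rw [h0]
    exact MeasurableSet.univ
  · have h0 : {d : n → ℂ | d i = d j → i = j} = {d | d i = d j}ᶜ := by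
      ext d
      simp [hij]
    rw [h0]
    exact (measurableSet_eq_fun (measurable_pi_apply i) (measurable_pi_apply j)).compl

/-! ## The primed eigenvalue map -/

/-- **A measurable `f'` equal to `f` at injective spectra and to the identity elsewhere exists.** -/
theorem exists_wallId_eigenvalueMap {f : (n → ℂ) → (n → ℂ)} (hfm : Measurable f) :
    ∃ f' : (n → ℂ) → (n → ℂ), Measurable f' ∧ (∀ d, Function.Injective d → f' d = f d) ∧
      ∀ d, ¬ Function.Injective d → f' d = d := by
  classical
  refine ⟨fun d => if Function.Injective d then f d else d,
    Measurable.ite measurableSet_setOf_injective hfm measurable_id, fun d hd => if_pos hd, fun d hd => if_neg hd⟩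

section WallId

variable {f f' : (n → ℂ) → (n → ℂ)} (hreg : ∀ d, Function.Injective d → f' d = f d)
  (hwall : ∀ d, ¬ Function.Injective d → f' d = d)

include hreg hwall

omit [DecidableEq n] in
/-- `f'` is permutation-equivariant everywhere as soon as `f` is at injective unimodular spectra. -/
theorem perm_wallId
    (hfperm : ∀ (σ : Equiv.Perm n) (d : n → ℂ), (∀ i, ‖d i‖ = 1) → Function.Injective d →
      f (fun i => d (σ i)) = fun i => f d (σ i))
    (σ : Equiv.Perm n) (d : n → ℂ) (hd : ∀ i, ‖d i‖ = 1) :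
    f' (fun i => d (σ i)) = fun i => f' d (σ i) := by
  by_cases hinj : Function.Injective d
  · have hinj' : Function.Injective fun i => d (σ i) := hinj.comp σ.injective
    rw [hreg _ hinj', hreg _ hinj, hfperm σ d hd hinj]
  · have hinj' : ¬ Function.Injective fun i => d (σ i) := fun h' => hinj (by
      intro a b hab
      have := @h' (σ.symm a) (σ.symm b) (by simpa using hab)
      simpa using this)
    rw [hwall _ hinj', hwall _ hinj]

omit [DecidableEq n] in
/-- `f'` preserves unimodularity everywhere as soon as `f` does at injective spectra. -/
theorem norm_wallId (hf1 : ∀ d : n → ℂ, (∀ i, ‖d i‖ = 1) → Function.Injective d → ∀ i, ‖f d i‖ = 1)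
    (d : n → ℂ) (hd : ∀ i, ‖d i‖ = 1) (i : n) : ‖f' d i‖ = 1 := by
  by_cases hinj : Function.Injective d
  · rw [hreg _ hinj]; exact hf1 d hd hinj i
  · rw [hwall _ hinj]; exact hd i

omit [DecidableEq n] in
/-- `f'` preserves unit product everywhere as soon as `f` does at injective spectra. -/
theorem prod_wallId
    (hfdet : ∀ d : n → ℂ, (∀ i, ‖d i‖ = 1) → Function.Injective d → ∏ i, d i = 1 → ∏ i, f d i = 1)
    (d : n → ℂ) (hd : ∀ i, ‖d i‖ = 1) (hprod : ∏ i, d i = 1) : ∏ i, f' d i = 1 := by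
  by_cases hinj : Function.Injective d
  · rw [hreg _ hinj]; exact hfdet d hd hinj hprod
  · rw [hwall _ hinj]; exact hprod

/-- **The recipe everywhere for the primed pair from the recipe at simple spectra.**  If `h` follows the
spectral recipe of `f` at every `P ∈ SU(N)` with simple spectrum, and `h' = h` there, `h' P = P` elsewhere,
then `h'` follows the recipe of `f'` in EVERY unitary diagonalization. -/
theorem hagree_wallId {h h' : Matrix.specialUnitaryGroup n ℂ → Matrix.specialUnitaryGroup n ℂ}
    (hagree : ∀ (P : Matrix.specialUnitaryGroup n ℂ) (V : Matrix n n ℂ) (d : n → ℂ),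
      V ∈ Matrix.unitaryGroup n ℂ → Function.Injective d → (P : Matrix n n ℂ) = V * diagonal d * star V →
        ((h P : Matrix.specialUnitaryGroup n ℂ) : Matrix n n ℂ) = V * diagonal (f d) * star V)
    (hhreg : ∀ P : Matrix.specialUnitaryGroup n ℂ, (P : Matrix n n ℂ).charpoly.Separable → h' P = h P)
    (hhwall : ∀ P : Matrix.specialUnitaryGroup n ℂ, ¬ (P : Matrix n n ℂ).charpoly.Separable → h' P = P)
    (P : Matrix.specialUnitaryGroup n ℂ) (V : Matrix n n ℂ) (d : n → ℂ) (hV : V ∈ Matrix.unitaryGroup n ℂ)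
    (hP : (P : Matrix n n ℂ) = V * diagonal d * star V) :
    ((h' P : Matrix.specialUnitaryGroup n ℂ) : Matrix n n ℂ) = V * diagonal (f' d) * star V := by
  by_cases hinj : Function.Injective d
  · have hsep : (P : Matrix n n ℂ).charpoly.Separable := (separable_charpoly_iff_injective_of_conj hV hP).mpr hinj
    rw [hhreg P hsep, hreg _ hinj]
    exact hagree P V d hV hinj hP
  · have hsep : ¬ (P : Matrix n n ℂ).charpoly.Separable := fun hs =>
      hinj ((separable_charpoly_iff_injective_of_conj hV hP).mp hs)
    rw [hhwall P hsep, hwall _ hinj]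
    exact hP

end WallId

/-! ## The primed kernel and the primed datum -/

/-- **A measurable `h'` equal to `h` at simple spectra and to the identity elsewhere exists.** -/
theorem exists_wallId_kernel {h : Matrix.specialUnitaryGroup n ℂ → Matrix.specialUnitaryGroup n ℂ}
    (hhm : Measurable h) :
    ∃ h' : Matrix.specialUnitaryGroup n ℂ → Matrix.specialUnitaryGroup n ℂ, Measurable h' ∧
      (∀ P : Matrix.specialUnitaryGroup n ℂ, (P : Matrix n n ℂ).charpoly.Separable → h' P = h P) ∧
      ∀ P : Matrix.specialUnitaryGroup n ℂ, ¬ (P : Matrix n n ℂ).charpoly.Separable → h' P = P := by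
  classical
  have hS : MeasurableSet {P : Matrix.specialUnitaryGroup n ℂ | (P : Matrix n n ℂ).charpoly.Separable} := by
    have h0 := Literature.MathematicalPhysics.QuantumFieldTheory.Balaban1983to89.HaarRegularElementsNull.measurableSet_specialUnitaryGroup_setOf_not_separable
      (n := n)
    have heq : {P : Matrix.specialUnitaryGroup n ℂ | (P : Matrix n n ℂ).charpoly.Separable} =
        {P : Matrix.specialUnitaryGroup n ℂ | ¬ (P : Matrix n n ℂ).charpoly.Separable}ᶜ := by
      ext P
      simp
    rw [heq]
    exact h0.compl
  exact ⟨fun P : Matrix.specialUnitaryGroup n ℂ => if (P : Matrix n n ℂ).charpoly.Separable then h P else P,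
    Measurable.ite hS hhm measurable_id, fun P hP => if_pos hP, fun P hP => if_neg hP⟩

/-- **A measurable datum `JD'` equal to `JD` at injective spectra and to `1` elsewhere exists.** -/
theorem exists_wallId_datum {JD : (n → ℂ) → ℝ≥0∞} (hJDm : Measurable JD) :
    ∃ JD' : (n → ℂ) → ℝ≥0∞, Measurable JD' ∧ (∀ d, Function.Injective d → JD' d = JD d) ∧
      ∀ d, ¬ Function.Injective d → JD' d = 1 := by
  classical
  exact ⟨fun d => if Function.Injective d then JD d else 1,
    Measurable.ite measurableSet_setOf_injective hJDm measurable_const, fun d hd => if_pos hd, fun d hd => if_neg hd⟩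

section Datum

variable {JD JD' : (n → ℂ) → ℝ≥0∞} (hDreg : ∀ d, Function.Injective d → JD' d = JD d)
  (hDwall : ∀ d, ¬ Function.Injective d → JD' d = 1)

include hDreg hDwall

omit [DecidableEq n] in
/-- `JD'` is permutation-invariant as soon as `JD` is at injective spectra. -/
theorem perm_wallId_datum
    (hJDperm : ∀ (σ : Equiv.Perm n) (d : n → ℂ), Function.Injective d → JD (fun i => d (σ i)) = JD d)
    (σ : Equiv.Perm n) (d : n → ℂ) : JD' (fun i => d (σ i)) = JD' d := by
  by_cases hinj : Function.Injective d
  · have hinj' : Function.Injective fun i => d (σ i) := hinj.comp σ.injective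
    rw [hDreg _ hinj', hDreg _ hinj, hJDperm σ d hinj]
  · have hinj' : ¬ Function.Injective fun i => d (σ i) := fun h' => hinj (by
      intro a b hab
      have := @h' (σ.symm a) (σ.symm b) (by simpa using hab)
      simpa using this)
    rw [hDwall _ hinj', hDwall _ hinj]

/-- **The spectral specification everywhere for the primed density.**  If `J W = JD d` in every unitary
diagonalization of every `W` with simple spectrum, and `J' = J` there, `J' = 1` elsewhere, then
`J' W = JD' d` in EVERY unitary diagonalization of every `W`. -/
theorem spec_wallId_datum {J J' : Matrix.specialUnitaryGroup n ℂ → ℝ≥0∞}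
    (hJspec : ∀ (W : Matrix.specialUnitaryGroup n ℂ) (V : Matrix n n ℂ) (d : n → ℂ),
      V ∈ Matrix.unitaryGroup n ℂ → Function.Injective d → (W : Matrix n n ℂ) = V * diagonal d * star V →
        J W = JD d)
    (hJreg : ∀ W : Matrix.specialUnitaryGroup n ℂ, (W : Matrix n n ℂ).charpoly.Separable → J' W = J W)
    (hJwall : ∀ W : Matrix.specialUnitaryGroup n ℂ, ¬ (W : Matrix n n ℂ).charpoly.Separable → J' W = 1)
    (W : Matrix.specialUnitaryGroup n ℂ) (V : Matrix n n ℂ) (d : n → ℂ) (hV : V ∈ Matrix.unitaryGroup n ℂ)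
    (hW : (W : Matrix n n ℂ) = V * diagonal d * star V) : J' W = JD' d := by
  by_cases hinj : Function.Injective d
  · have hsep : (W : Matrix n n ℂ).charpoly.Separable := (separable_charpoly_iff_injective_of_conj hV hW).mpr hinj
    rw [hJreg W hsep, hDreg _ hinj]
    exact hJspec W V d hV hinj hW
  · have hsep : ¬ (W : Matrix n n ℂ).charpoly.Separable := fun hs =>
      hinj ((separable_charpoly_iff_injective_of_conj hV hW).mp hs)
    rw [hJwall W hsep, hDwall _ hinj]

end Datum

/-! ## Agreement at simple spectra is agreement Haar-a.e. -/

/-- **Two functions on `SU(N)` that agree at simple spectra are equal Haar-a.e.** -/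
theorem ae_eq_of_eqOn_separable [Nonempty n] {α : Type*} {g g' : Matrix.specialUnitaryGroup n ℂ → α}
    (hg : ∀ P : Matrix.specialUnitaryGroup n ℂ, (P : Matrix n n ℂ).charpoly.Separable → g' P = g P) :
    g' =ᵐ[haarProbability (Matrix.specialUnitaryGroup n ℂ)] g := by
  haveI : (haarProbability (Matrix.specialUnitaryGroup n ℂ)).IsHaarMeasure := Measure.isHaarMeasure_haarMeasure ⊤
  filter_upwards [Literature.MathematicalPhysics.QuantumFieldTheory.Balaban1983to89.HaarRegularElementsNull.ae_separable_charpoly_specialUnitaryGroup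
    (haarProbability (Matrix.specialUnitaryGroup n ℂ))] with P hP
  exact hg P hP

end Summit.Ventures.LatticeQCDFlow.Exactness
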